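import Summits.NavierStokesRegularity.FluidComputer.AngularGalerkinLadderScaling
import Literature.Analysis.FluidPDE.AncientSimilarityVariables

/-!
# Rung solutions in backward similarity variables: the FORCED Navier–Stokes ⇔ backward-Leray
# dictionary, and `NS_L` on the past as the backward Leray system with a co-band-limited defect

Circuit seat (ns-blowup-circuit g10), route-independent kernel tools `--supports` crux K1
`RungBlowupCofinal` (stmt-NavierStokesRegularity-19959, helper lane); no definition, no named fact.

## Why

Every K1/K2 object of route `AngularGalerkinLadder` lives naturally in the backward similarity
variables `U(s,y) = √(−t) u(t,x)`, `s = −log(−t)`, `y = x/√(−t)` (tree `lerayOrbit`,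
`AncientSimilarityVariables.lean`): steady profiles = Leray roots (the cell's MODEL line Z2-OCT and
its ℓ-ladder ARE the steady reduced systems in these variables), time-periodic profiles = DSS
windows, rotating waves = precessing (Pineau–Vicol) profiles. The tree's dictionary
`isClassicalNSSolutionOn_iff_isBackwardLeraySolutionOn_lerayOrbit` is stated for UNFORCED
Navier–Stokes; a rung solution is Navier–Stokes FORCED by its Galerkin defect `d`. This file adds:
* `lerayOrbit_momentum_iff_forced` — the momentum equation term by term WITH a force `f`
  (similarity side: Leray drift `−½(U + (y·∇)U)` plus `lerayOrbitForce f`, weight `e^{−3s/2}`);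
* `isClassicalNSSolutionOn_iff_backwardLeray_forced` — for open `T ⊆ (−∞,0)`: `(u, p)` classical
  Navier–Stokes FORCED by `f` on `T` iff `(lerayOrbit u, lerayOrbitPressure p)` is classical on
  `τ⁻¹(T)` with force `rescaledEulerLerayForce 1 (lerayOrbit u) + lerayOrbitForce f`;
* **`isRungSolutionOn_Iio_iff_similarity`** — `IsRungSolutionOn (Iio 0) ν L u p d` iff the orbit
  triple solves that forced backward-Leray system on ALL of `ℝ` with band-limited velocity slices
  and co-band-limited defect slices `lerayOrbitForce d s` (the Casimir cut commutes with the
  dilations of the change of variables: tree `IsBandLimited.smul_comp_smul`,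
  `IsCobandLimited.smul_comp_smul`, `FluidComputer/AngularGalerkinLadderScaling.lean`).
So «a rung profile» = «a solution of the backward Leray system with co-band-limited defect in
similarity variables», steady ⇔ self-similar (tree `IsSelfSimilar.lerayOrbit` dictionary),
periodic ⇔ DSS — the frame in which the registered line `Cruxes/RungBlowupCofinal/Lines/leray.lean`
poses its Newton–Kantorovich door.

LABEL: KERNEL (calculus bookkeeping over the tree's dictionary). WHAT THIS IS NOT: not NS — no
solution is constructed; no item moves.
References: [cite: ChaeWolf2017RemovingDSS, §4 (arXiv:1610.09464 p. 10)]; [cite: Leray1934, §20 (3.11)–(3.12)];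
[cite: KochNadirashviliSereginSverak2009, (1.6)].
-/

noncomputable section

namespace Summit.NavierStokesRegularity.AngularGalerkinLadderRungSimilarity

open Set Function
open scoped Laplacian ContDiff
open Literature.Analysis.FluidPDE
open Summit.NavierStokesRegularity.FluidComputer
open Summit.NavierStokesRegularity.FluidComputer.AngularLadder

variable {E : Type*} [NormedAddCommGroup E] [InnerProductSpace ℝ E] [FiniteDimensional ℝ E]

/-! ### §1 The forced momentum equation, term by term -/

/-- **Forced momentum, term by term.** If `uncurry u` is differentiable at `Φ(s,y)` and the slice
`u(t)`, `t = −e^{−s}`, is `C²`, then the backward-Leray momentum equation for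
`(lerayOrbit u, lerayOrbitPressure p)` with force `Leray drift + lerayOrbitForce f` holds at
`(s, y)` iff the Navier–Stokes momentum equation with force `f` holds for `(u, p)` at
`(t, x) = Φ(s, y)` (every term is `e^{−3s/2}` times its physical counterpart). [cite: ChaeWolf2017RemovingDSS, §4] -/
theorem lerayOrbit_momentum_iff_forced {ν : ℝ} {u f : ℝ → E → E} {p : ℝ → E → ℝ} {s : ℝ} {y : E}
    (hd : DifferentiableAt ℝ (uncurry u) (ancientSimMap (s, y)))
    (h2 : ContDiff ℝ 2 (u (-Real.exp (-s)))) :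
    timeDeriv (lerayOrbit u) s y + convect (lerayOrbit u s) (lerayOrbit u s) y =
        ν • (Δ (lerayOrbit u s)) y - gradient (lerayOrbitPressure p s) y
          + (rescaledEulerLerayForce 1 (lerayOrbit u) s y + lerayOrbitForce f s y) ↔
      timeDeriv u (-Real.exp (-s)) (Real.exp (-s / 2) • y)
          + convect (u (-Real.exp (-s))) (u (-Real.exp (-s))) (Real.exp (-s / 2) • y) =
        ν • (Δ (u (-Real.exp (-s)))) (Real.exp (-s / 2) • y)
          - gradient (p (-Real.exp (-s))) (Real.exp (-s / 2) • y)
          + f (-Real.exp (-s)) (Real.exp (-s / 2) • y) := by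
  have hT := lerayOrbitForce_timeDeriv (u := u) (s := s) (y := y) hd
  rw [rescaledEulerLerayForce_apply, convect_lerayOrbit, laplacian_lerayOrbit _ _ _ h2,
    gradient_lerayOrbitPressure]
  have hT' : timeDeriv (lerayOrbit u) s y = lerayOrbitForce (timeDeriv u) s y -
      ((1 / 2 : ℝ) • lerayOrbit u s y + (1 / 2 : ℝ) • fderiv ℝ (lerayOrbit u s) y y) := by
    rw [← hT]; abel
  rw [hT']
  simp only [lerayOrbitForce_apply]
  set a : ℝ := Real.exp (-s / 2) with ha_def
  set T := timeDeriv u (-Real.exp (-s)) (a • y)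
  set C := convect (u (-Real.exp (-s))) (u (-Real.exp (-s))) (a • y)
  set G := gradient (p (-Real.exp (-s))) (a • y)
  set D := (Δ (u (-Real.exp (-s)))) (a • y)
  set F := f (-Real.exp (-s)) (a • y)
  set V := lerayOrbit u s y
  set W := fderiv ℝ (lerayOrbit u s) y y
  have ha : a ^ 3 ≠ 0 := pow_ne_zero _ (Real.exp_pos _).ne'
  have key : (a ^ 3 • T - ((1 / 2 : ℝ) • V + (1 / 2 : ℝ) • W) + a ^ 3 • C) -
      (ν • a ^ 3 • D - a ^ 3 • G + (-(((1 : ℝ) / 2) • (V + W)) + a ^ 3 • F)) =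
      a ^ 3 • (T + C - (ν • D - G + F)) := by
    module
  constructor
  · intro h
    have h0 : a ^ 3 • (T + C - (ν • D - G + F)) = 0 := by rw [← key, h, sub_self]
    rwa [smul_eq_zero_iff_right ha, sub_eq_zero] at h0
  · intro h
    rw [← sub_eq_zero, key, h, sub_self, smul_zero]

/-! ### §2 Forced Navier–Stokes on the past ⇔ forced backward Leray system -/

/-- **Forced Navier–Stokes on the past ⇔ the backward Leray system with the transported force.**
For an open time set `T ⊆ (−∞, 0)`, `(u, p)` is a classical Navier–Stokes solution with
viscosity `ν` FORCED by `f` on `T × E` iff `(lerayOrbit u, lerayOrbitPressure p)` is a classical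
solution on `τ⁻¹(T) × E` with force `rescaledEulerLerayForce 1 (lerayOrbit u) + lerayOrbitForce f`
(Leray drift + transported force). Same proof as the tree's unforced
`isClassicalNSSolutionOn_iff_isBackwardLeraySolutionOn_lerayOrbit`, with `lerayOrbit_momentum_iff_forced`.
[cite: ChaeWolf2017RemovingDSS, §4 (proof of Thm. 1.5)] -/
theorem isClassicalNSSolutionOn_iff_backwardLeray_forced {T : Set ℝ} (hT : IsOpen T)
    (hT0 : T ⊆ Iio 0) {ν : ℝ} {u f : ℝ → E → E} {p : ℝ → E → ℝ} :
    IsClassicalNSSolutionOn T ν f u p ↔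
      IsClassicalNSSolutionOn (ancientSimTime ⁻¹' T) ν
        (fun s y => rescaledEulerLerayForce 1 (lerayOrbit u) s y + lerayOrbitForce f s y)
        (lerayOrbit u) (lerayOrbitPressure p) := by
  have hS : IsOpen (ancientSimTime ⁻¹' T) := isOpen_preimage_ancientSimTime hT
  constructor
  · intro h
    refine ⟨h.smooth_velocity.lerayOrbit, h.smooth_pressure.lerayOrbitPressure, fun s hs y => ?_,
      fun s hs => (isDivFree_lerayOrbit_iff u s).2 (h.divFree _ hs)⟩
    have ht : -Real.exp (-s) ∈ T := hs
    have hd : DifferentiableAt ℝ (uncurry u) (ancientSimMap (s, y)) :=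
      (h.smooth_velocity.contDiffAt hT ht _).differentiableAt (by simp)
    have h2 : ContDiff ℝ 2 (u (-Real.exp (-s))) := (h.contDiff_velocity ht).of_le (by norm_cast)
    rw [timeDerivWithin_eq_deriv hS hs, ← timeDeriv_apply, lerayOrbit_momentum_iff_forced hd h2]
    have hm := h.momentum _ ht (Real.exp (-s / 2) • y)
    rw [timeDerivWithin_eq_deriv hT ht, ← timeDeriv_apply] at hm
    exact hm
  · intro h
    have hsm_u : IsSmoothSpaceTimeOn T u := by
      have h1 := h.smooth_velocity.ofLerayOrbit
      rw [image_preimage_ancientSimTime hT0] at h1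
      refine ContDiffOn.congr h1 ?_
      rintro ⟨t, x⟩ ⟨ht, -⟩
      simp only [uncurry_apply_pair, ofLerayOrbit_lerayOrbit_slice u (hT0 ht)]
    have hsm_p : IsSmoothSpaceTimeOn T p := by
      have h1 := h.smooth_pressure.ofLerayOrbitPressure
      rw [image_preimage_ancientSimTime hT0] at h1
      refine ContDiffOn.congr h1 ?_
      rintro ⟨t, x⟩ ⟨ht, -⟩
      simp only [uncurry_apply_pair, ofLerayOrbitPressure_lerayOrbitPressure_slice p (hT0 ht)]
    refine ⟨hsm_u, hsm_p, fun t ht x => ?_, fun t ht => ?_⟩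
    · have ht0 : t < 0 := hT0 ht
      set s := -Real.log (-t) with hs_def
      have hts : -Real.exp (-s) = t := by rw [hs_def, neg_neg, Real.exp_log (neg_pos.2 ht0), neg_neg]
      have hs : s ∈ ancientSimTime ⁻¹' T := by
        show -Real.exp (-s) ∈ T
        rw [hts]; exact ht
      have ha : Real.exp (-s / 2) ≠ 0 := (Real.exp_pos _).ne'
      set y := (Real.exp (-s / 2))⁻¹ • x with hy
      have hxy : Real.exp (-s / 2) • y = x := by
        rw [hy, smul_smul, mul_inv_cancel₀ ha, one_smul]
      have hd : DifferentiableAt ℝ (uncurry u) (ancientSimMap (s, y)) := by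
        rw [ancientSimMap_apply, hts, hxy]
        exact (hsm_u.contDiffAt hT ht x).differentiableAt (by simp)
      have h2 : ContDiff ℝ 2 (u (-Real.exp (-s))) := by
        rw [hts]; exact (hsm_u.contDiff_slice ht).of_le (by norm_cast)
      have hm := h.momentum s hs y
      rw [timeDerivWithin_eq_deriv hS hs, ← timeDeriv_apply, lerayOrbit_momentum_iff_forced hd h2,
        hts, hxy] at hm
      rw [timeDerivWithin_eq_deriv hT ht, ← timeDeriv_apply]
      exact hm
    · have ht0 : t < 0 := hT0 ht
      have hts : -Real.exp (-(-Real.log (-t))) = t := by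
        rw [neg_neg, Real.exp_log (neg_pos.2 ht0), neg_neg]
      have hs : -Real.log (-t) ∈ ancientSimTime ⁻¹' T := by
        show -Real.exp (-(-Real.log (-t))) ∈ T
        rw [hts]; exact ht
      have key := (isDivFree_lerayOrbit_iff u _).1 (h.divFree _ hs)
      rwa [hts] at key

/-- **The whole past, forced.** `(u, p)` is a classical Navier–Stokes solution forced by `f` on
`(−∞, 0) × E` iff the orbit triple solves the forced backward Leray system on all of `ℝ × E`.
[cite: ChaeWolf2017RemovingDSS, §4] -/
theorem isClassicalNSSolutionOn_Iio_iff_backwardLeray_forced {ν : ℝ} {u f : ℝ → E → E}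
    {p : ℝ → E → ℝ} :
    IsClassicalNSSolutionOn (Iio 0) ν f u p ↔
      IsClassicalNSSolutionOn univ ν
        (fun s y => rescaledEulerLerayForce 1 (lerayOrbit u) s y + lerayOrbitForce f s y)
        (lerayOrbit u) (lerayOrbitPressure p) := by
  rw [isClassicalNSSolutionOn_iff_backwardLeray_forced isOpen_Iio Subset.rfl,
    preimage_ancientSimTime_Iio]

/-! ### §3 Rung solutions of the angular Galerkin ladder in similarity variables -/

/-- **`NS_L` on the past = the backward Leray system with a co-band-limited defect.** A triple
`(u, p, d)` is a rung-`L` solution on `(−∞, 0)` (viscosity `ν`) iff, in backward similarity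
variables, `(lerayOrbit u, lerayOrbitPressure p)` is a classical solution on all of `ℝ × ℝ³` with
force `Leray drift + lerayOrbitForce d`, every velocity slice `lerayOrbit u s` is band-limited to
degree `≤ L`, and every defect slice `lerayOrbitForce d s` is co-band-limited — the Casimir cut
commutes with the dilations of the change of variables (tree `IsBandLimited.smul_comp_smul`,
`IsCobandLimited.smul_comp_smul`). Steady orbit triples are exactly the Leray-type rung profiles
of `LerayLineRungProfile.lean`; `2 log c`-periodic ones are the `c`-DSS rung profiles.
[cite: ChaeWolf2017RemovingDSS, §4] [cite: BullardGellman1954] -/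
theorem isRungSolutionOn_Iio_iff_similarity {ν : ℝ} {L : ℕ}
    {u d : ℝ → EuclideanSpace ℝ (Fin 3) → EuclideanSpace ℝ (Fin 3)}
    {p : ℝ → EuclideanSpace ℝ (Fin 3) → ℝ} :
    IsRungSolutionOn (Iio 0) ν L u p d ↔
      IsClassicalNSSolutionOn univ ν
          (fun s y => rescaledEulerLerayForce 1 (lerayOrbit u) s y + lerayOrbitForce d s y)
          (lerayOrbit u) (lerayOrbitPressure p) ∧
        (∀ s, IsBandLimited L (lerayOrbit u s)) ∧ ∀ s, IsCobandLimited L (lerayOrbitForce d s) := by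
  constructor
  · rintro ⟨hcl, hband, hcob⟩
    refine ⟨isClassicalNSSolutionOn_Iio_iff_backwardLeray_forced.1 hcl, fun s => ?_, fun s => ?_⟩
    · have ht : -Real.exp (-s) ∈ Iio (0 : ℝ) := neg_exp_neg_lt_zero s
      have h := (hband _ ht).smul_comp_smul (Real.exp (-s / 2)) (Real.exp (-s / 2))
      rw [lerayOrbit_slice]; exact h
    · have ht : -Real.exp (-s) ∈ Iio (0 : ℝ) := neg_exp_neg_lt_zero s
      have ha : Real.exp (-s / 2) ≠ 0 := (Real.exp_pos _).ne'
      have h := (hcob _ ht).smul_comp_smul ha (Real.exp (-s / 2) ^ 3)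
      have hfun : lerayOrbitForce d s =
          fun y => Real.exp (-s / 2) ^ 3 • d (-Real.exp (-s)) (Real.exp (-s / 2) • y) := rfl
      rw [hfun]; exact h
  · rintro ⟨hcl, hband, hcob⟩
    refine ⟨isClassicalNSSolutionOn_Iio_iff_backwardLeray_forced.2 hcl, fun t ht => ?_, fun t ht => ?_⟩
    · have ht0 : t < 0 := ht
      set s := -Real.log (-t) with hs_def
      have hts : -Real.exp (-s) = t := by rw [hs_def, neg_neg, Real.exp_log (neg_pos.2 ht0), neg_neg]
      set a : ℝ := Real.exp (-s / 2) with ha_def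
      have ha : a ≠ 0 := (Real.exp_pos _).ne'
      have hfun : u t = fun x => a⁻¹ • lerayOrbit u s (a⁻¹ • x) := by
        funext x
        simp only [lerayOrbit_apply, ← ha_def, hts, smul_smul, mul_inv_cancel₀ ha, inv_mul_cancel₀ ha,
          one_smul]
      rw [hfun]
      exact (hband s).smul_comp_smul a⁻¹ a⁻¹
    · have ht0 : t < 0 := ht
      set s := -Real.log (-t) with hs_def
      have hts : -Real.exp (-s) = t := by rw [hs_def, neg_neg, Real.exp_log (neg_pos.2 ht0), neg_neg]
      set a : ℝ := Real.exp (-s / 2) with ha_def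
      have ha : a ≠ 0 := (Real.exp_pos _).ne'
      have ha3 : a ^ 3 ≠ 0 := pow_ne_zero _ ha
      have hfun : d t = fun x => (a ^ 3)⁻¹ • lerayOrbitForce d s (a⁻¹ • x) := by
        funext x
        simp only [lerayOrbitForce_apply, ← ha_def, hts, smul_smul, mul_inv_cancel₀ ha,
          inv_mul_cancel₀ ha3, one_smul]
      rw [hfun]
      exact (hcob s).smul_comp_smul (inv_ne_zero ha) _

end Summit.NavierStokesRegularity.AngularGalerkinLadderRungSimilarity

end
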